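import Literature.AlgebraicGeometry.Motives.CartierDivisorLinEquivIso
import Literature.AlgebraicGeometry.Modules.LineBundleOfCocyclePullbackComp
import Literature.AlgebraicGeometry.Motives.FunctionFieldOver
import HarnessLib

/-!
# The named isomorphism `g^* 𝒪_Y(D) ≅ 𝒪_X(g^* D)` of glued line bundles, with its section formula in `K(X)`
# (Görtz–Wedhorn I, Def. 11.49 / Prop. 11.50: pull-back of Cartier divisors and `g^*𝒪(D) ≅ 𝒪(g^*D)`)

Layer `Literature/AlgebraicGeometry/Motives`, namespace `Literature.AlgebraicGeometry.Motives.CartierDivisor` (dot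
notation on `D`). DEFINITIONS WITH BODIES AND THEOREMS ONLY (no named fact, no instance, no notation, no `sorry`);
everything is proved.

For a dominant morphism `g : X ⟶ Y` of integral schemes and a Cartier divisor `D = (U_i, f_i)` on `Y`, the tree has the
pulled-back divisor `g^* D = (g⁻¹ U_i, g^♯ f_i)` (★ `CartierDivisor.pullback`), the CLASS identity `[𝒪(g^*D)] = g^*[𝒪(D)]`
(★ `CartierDivisor.cechClass_pullback`) and hence `Nonempty (g^*𝒪_Y(D) ≅ 𝒪_X(g^*D))` (★
`nonempty_pullback_lineBundle_toUnitCocycle_iso`), and — since ★ p761292 — THE NATURAL isomorphism of `𝒪_X`-modules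
`g^*(lineBundle c) ≅ lineBundle (c.pullback g)` for any cocycle `c` (★ `UnitCocycle.pullbackLineBundleIso`). This file
closes the triangle:

* `CartierDivisor.toUnitCocycle_pullback` — the two point-indexed cocycles of `𝒪_X(g^*D)` AGREE ON THE NOSE:
  `(g^*D).toUnitCocycle = (D.toUnitCocycle).pullback g` (same charts `g⁻¹U_{i(g x)}`, transition functions the sections with
  rational function `g^♯(f_i/f_j)`; ★ `UnitCocycle.ext'`);
* `CartierDivisor.pullbackLineBundleIso D g : g^*(Modules.lineBundle D.toUnitCocycle) ≅ Modules.lineBundle (g^*D).toUnitCocycle`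
  — ★ `UnitCocycle.pullbackLineBundleIso g D.toUnitCocycle` followed by the identification of equal cocycles (★ `eqToIso`,
  sections cast-free by ★ `comp_eqToHom_app`);
* **the section formula** `lineBundleRatFn_pullbackLineBundleIso_hom_app_unitSection`: for a section `s` of `𝒪_Y(D)` over a
  non-empty `W`, the pulled-back section `η(s)` goes to the section of `𝒪_X(g^*D)` over `g⁻¹W` WITH RATIONAL FUNCTION
  `g^♯ φ_D(s)` ([GortzWedhorn2020] Prop. 11.50 (b): `𝒪_Y → g_*𝒪_X` extends to `𝒦_Y → g_*𝒦_X`, `f ↦ g^♯ f`); on generators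
  `η(t_{g x}) ↦ t'_x` (`pullbackLineBundleIso_hom_app_unitSection_lineBundleGen`).

Engines (all ★ / Mathlib): `UnitCocycle.pullbackLineBundleIso` / `pullbackHom_app_unitSection` / `comp_pullbackFlatFun` /
`pullbackHom_app_unitSection_lineBundleGen` (★ `Modules/LineBundleOfCocyclePullback`), `UnitCocycle.ext'` /
`comp_eqToHom_app` / `eqToHom_app_lineBundleGen` (★ `Modules/LineBundleOfCocyclePullbackComp`),
`RatFn.functionFieldMap_ofSection` (★ `Motives/FunctionFieldOver`), `CartierDivisor.lineBundleRatFn_eq` /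
`ofSection_toUnitCocycle_g` (★ `CartierDivisorLineBundleSectionsOn`). Mathlib searched (pin): no Cartier divisors /
`𝒪_X(D)` for schemes; `Scheme.Modules.pullback` is the abstract left adjoint ([StacksProject, Tag 01CB]).

Consumers: the (h9-S)/(D-2) dictionary of cell hodgecm-mathlib (★ `AbelianSchemeDualTransportLambda`, `IsLambdaOfAt*`:
today `Nonempty` only) and every «pull back a trivialisation / a linear equivalence» step (compose with ★
`unitIsoOfRatFn`, `linEquivIso` of the two prequel files). Count-neutral; HC_CM is proved only modulo the 7 printed citations
until rung 0 closes.

## References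
* [GortzWedhorn2020] U. Görtz, T. Wedhorn, *Algebraic Geometry I: Schemes*, 2nd ed., Springer Spektrum (2020): Def. 11.49
  and Prop. 11.50 (b) (inverse image of divisors, `g^*𝒪_Y(D) ≅ 𝒪_X(g^*D)`), Section (11.9) (p. 301), Rem. 11.16 (cocycles and
  glued modules), Prop. 3.29 (2) (p. 80).
* [Hartshorne1977] R. Hartshorne, *Algebraic Geometry*, GTM 52 (1977), II Ex. 6.8 (a) (`f^*` on `Pic` via transition
  functions).
-/

noncomputable section

open CategoryTheory AlgebraicGeometry Opposite TopologicalSpace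

namespace Literature.AlgebraicGeometry.Motives.CartierDivisor

open RatFn Literature.AlgebraicGeometry.Modules

universe u

variable {X Y : Scheme.{u}} [IsIntegral X] [IsIntegral Y] (D : CartierDivisor Y) (g : X ⟶ Y) [IsDominant g]

/-! ### §1 The two cocycles of `𝒪_X(g^* D)` agree -/

/-- The rational function of `g^♯` of a restricted section: `ofSection (g.appLE U V e r) = g^♯ (ofSection r)`.
[cite: GortzWedhorn2020, Prop. 11.50 (b)] -/
theorem ofSection_appLE' {U : Y.Opens} {V : X.Opens} (e : V ≤ g ⁻¹ᵁ U) (hV : genericPoint X ∈ V)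
    (hU : genericPoint Y ∈ U) (r : Γ(Y, U)) :
    ofSection hV (g.appLE U V e r) = functionFieldMap g (ofSection hU r) := by
  rw [Scheme.Hom.appLE, CommRingCat.comp_apply, ofSection_map, functionFieldMap_ofSection]

/-- **The cocycle of the pulled-back divisor IS the pulled-back cocycle**: `(g^*D).toUnitCocycle = D.toUnitCocycle.pullback g`
— both live on the charts `g⁻¹ U_{i(g x)}` (definitionally) and both transition functions over `V` are the section with
rational function `g^♯(f_{i(gx)} / f_{i(gy)})` ([GortzWedhorn2020] Def. 11.49: `g^*D = (g⁻¹U_i, g^♯ f_i)`; Rem. 11.16: the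
cocycle of `𝒪(D)` is `f_i/f_j`). [cite: GortzWedhorn2020, Def. 11.49 and Rem. 11.16] -/
theorem toUnitCocycle_pullback : (D.pullback g).toUnitCocycle = D.toUnitCocycle.pullback g := by
  refine UnitCocycle.ext' (fun _ => rfl) fun x y V hx₁ hy₁ hx₂ hy₂ => RatFn.section_ext fun hV => ?_
  have hU : genericPoint Y ∈ D.toUnitCocycle.U (g.base x) ⊓ D.toUnitCocycle.U (g.base y) :=
    ⟨genericPoint_mem_of_mem (D.toUnitCocycle.mem (g.base x)), genericPoint_mem_of_mem (D.toUnitCocycle.mem (g.base y))⟩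
  rw [(D.pullback g).ofSection_toUnitCocycle_g x y hx₁ hy₁ hV, UnitCocycle.pullback_g, ofSection_appLE' g _ hV hU,
    D.ofSection_toUnitCocycle_g _ _ inf_le_left inf_le_right hU, map_div₀]
  rfl

/-! ### §2 The isomorphism `g^* 𝒪_Y(D) ≅ 𝒪_X(g^* D)` -/

/-- **`g^* 𝒪_Y(D) ≅ 𝒪_X(g^* D)`** as a NAMED isomorphism of `𝒪_X`-modules: the natural isomorphism
`g^*(lineBundle c) ≅ lineBundle (c.pullback g)` (★ `UnitCocycle.pullbackLineBundleIso`) for `c = D.toUnitCocycle`, followed by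
the identification of the equal cocycles `D.toUnitCocycle.pullback g = (g^*D).toUnitCocycle`.
[cite: GortzWedhorn2020, Def. 11.49 and Prop. 11.50 (b)] [cite: Hartshorne1977, II Ex. 6.8 (a)] -/
def pullbackLineBundleIso :
    (Scheme.Modules.pullback g).obj (Modules.lineBundle D.toUnitCocycle) ≅ Modules.lineBundle (D.pullback g).toUnitCocycle :=
  UnitCocycle.pullbackLineBundleIso g D.toUnitCocycle ≪≫
    eqToIso (congrArg Modules.lineBundle (D.toUnitCocycle_pullback g).symm)

/-- Unfolding: the `hom` is ★ `pullbackHom g D.toUnitCocycle` followed by the `eqToHom` of equal cocycles.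
[cite: GortzWedhorn2020, Def. 11.49 and Prop. 11.50 (b)] -/
theorem pullbackLineBundleIso_hom :
    (D.pullbackLineBundleIso g).hom = UnitCocycle.pullbackHom g D.toUnitCocycle ≫
      eqToHom (congrArg Modules.lineBundle (D.toUnitCocycle_pullback g).symm) := rfl

/-- **Components of the image of a pulled-back section**: the `x`-component of the image of `η(s)` (`s` a section of
`𝒪_Y(D)` over `W`) is `g^♯(s_{g x})` (restricted along the definitional equality of charts).
[cite: GortzWedhorn2020, Prop. 11.50 (b)] [cite: Hartshorne1977, II Ex. 6.8 (a)] -/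
theorem comp_pullbackLineBundleIso_hom_app_unitSection (W : Y.Opens) (s : Γ(Modules.lineBundle D.toUnitCocycle, W))
    (x : X) :
    (D.pullback g).toUnitCocycle.comp
        ((D.pullbackLineBundleIso g).hom.app (g ⁻¹ᵁ W) (unitSection g (Modules.lineBundle D.toUnitCocycle) W s)) x =
      secRes X (by rw [D.toUnitCocycle_pullback g]) (UnitCocycle.pullComp g D.toUnitCocycle W s x) := by
  rw [pullbackLineBundleIso_hom, Scheme.Modules.Hom.comp_app, CategoryTheory.comp_apply,
    UnitCocycle.comp_eqToHom_app (D.toUnitCocycle_pullback g).symm, UnitCocycle.comp_pullbackHom_app_unitSection]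

/-- **THE SECTION FORMULA**: the image of the pulled-back section `η(s)` is the section of `𝒪_X(g^*D)` over `g⁻¹W` whose
rational function is `g^♯ φ_D(s)` ([GortzWedhorn2020] Prop. 11.50 (b): `𝒪_Y ⊆ 𝒦_Y` pulls back by `f ↦ g^♯ f`, so
`g^*𝒪_Y(D) = 𝒪_X(g^*D)` inside `𝒦_X`). [cite: GortzWedhorn2020, Prop. 11.50 (b)] -/
theorem lineBundleRatFn_pullbackLineBundleIso_hom_app_unitSection {W : Y.Opens} (hW : genericPoint Y ∈ W)
    (s : Γ(Modules.lineBundle D.toUnitCocycle, W)) :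
    (D.pullback g).lineBundleRatFn (genericPoint_mem_preimage g hW)
        ((D.pullbackLineBundleIso g).hom.app (g ⁻¹ᵁ W) (unitSection g (Modules.lineBundle D.toUnitCocycle) W s)) =
      functionFieldMap g (D.lineBundleRatFn hW s) := by
  set ξ := genericPoint X
  rw [(D.pullback g).lineBundleRatFn_eq _ _ ξ, comp_pullbackLineBundleIso_hom_app_unitSection, ofSection_secRes]
  unfold UnitCocycle.pullComp
  rw [ofSection_appLE' g _ _ (D.genericPoint_mem_inf_toUnitCocycle_U hW (g.base ξ)), D.ofSection_comp_eq hW s (g.base ξ),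
    map_mul, pullback_f]
  -- the chart of `g^*D` at `ξ` is the chart of `D` at `g ξ` (definitionally)
  change functionFieldMap g (D.f (D.chartIdx (g.base ξ))) * _ / functionFieldMap g (D.f (D.chartIdx (g.base ξ))) = _
  rw [mul_div_cancel_left₀ _ ((map_ne_zero _).2 (D.f_ne_zero _))]

/-- **On generators**: the image of `η(t_{g x})` (the pulled-back local generator of `𝒪_Y(D)` over `U_{i(g x)}`) is the local
generator `t'_x` of `𝒪_X(g^*D)` over `g⁻¹U_{i(g x)}`. [cite: GortzWedhorn2020, Rem. 11.16 and Def. 11.49] [cite: Hartshorne1977, II Ex. 6.8 (a)] -/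
theorem pullbackLineBundleIso_hom_app_unitSection_lineBundleGen (x : X) :
    (D.pullbackLineBundleIso g).hom.app (g ⁻¹ᵁ D.toUnitCocycle.U (g.base x))
        (unitSection g (Modules.lineBundle D.toUnitCocycle) (D.toUnitCocycle.U (g.base x))
          (D.toUnitCocycle.lineBundleGen (g.base x) (D.toUnitCocycle.U (g.base x)) le_rfl)) =
      (D.pullback g).toUnitCocycle.lineBundleGen x (g ⁻¹ᵁ D.toUnitCocycle.U (g.base x)) le_rfl := by
  rw [pullbackLineBundleIso_hom, Scheme.Modules.Hom.comp_app, CategoryTheory.comp_apply,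
    UnitCocycle.pullbackHom_app_unitSection_lineBundleGen,
    UnitCocycle.eqToHom_app_lineBundleGen (D.toUnitCocycle_pullback g).symm]

/-- The rational function of the image of `η(t_z|_V)` for any `V ≤ U_z` (`z ∈ Y`): `g^♯(1 / f_{i(z)})`.
[cite: GortzWedhorn2020, Prop. 11.50 (b) and Rem. 11.16] -/
theorem lineBundleRatFn_pullbackLineBundleIso_hom_app_unitSection_lineBundleGen (z : Y) {V : Y.Opens}
    (hV : V ≤ D.toUnitCocycle.U z) (hξ : genericPoint Y ∈ V) :
    (D.pullback g).lineBundleRatFn (genericPoint_mem_preimage g hξ)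
        ((D.pullbackLineBundleIso g).hom.app (g ⁻¹ᵁ V)
          (unitSection g (Modules.lineBundle D.toUnitCocycle) V (D.toUnitCocycle.lineBundleGen z V hV))) =
      (functionFieldMap g (D.f (D.chartIdx z)))⁻¹ := by
  rw [D.lineBundleRatFn_pullbackLineBundleIso_hom_app_unitSection g hξ, D.lineBundleRatFn_lineBundleGen z hV hξ, map_inv₀]

/-! ### §3 Pulling back trivialisations and linear equivalences -/

variable {D}

/-- **Pull-back of the hypothesis of ★ `unitIsoOfRatFn`**: if `h / f_i` is a unit on `U_i` then `g^♯h / g^♯f_i` is a unit on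
`g⁻¹U_i`. [cite: GortzWedhorn2020, Def. 11.49 and Prop. 11.50 (b)] -/
theorem isUnitAt_div_pullback_f {h : Y.functionField} (hD : ∀ (i : D.ι) (y : Y), y ∈ D.U i → IsUnitAt y (h / D.f i))
    (i : (D.pullback g).ι) (x : X) (hx : x ∈ (D.pullback g).U i) :
    IsUnitAt x (functionFieldMap g h / (D.pullback g).f i) := by
  rw [pullback_f, ← map_div₀]
  exact (hD i (g.base x) hx).functionFieldMap

/-- **Pull-back of the hypothesis of ★ `ratFnMulIso`**: if `g_j m / f_i` is a unit on `U_i ∩ V_j` then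
`g^♯g_j · g^♯m / g^♯f_i` is a unit on `g⁻¹U_i ∩ g⁻¹V_j`. [cite: GortzWedhorn2020, Def. 11.49 and Prop. 11.50 (b)] -/
theorem isUnitAt_mul_div_pullback_f {E : CartierDivisor Y} {m : Y.functionField}
    (hm : ∀ (i : D.ι) (j : E.ι) (y : Y), y ∈ D.U i → y ∈ E.U j → IsUnitAt y (E.f j * m / D.f i))
    (i : (D.pullback g).ι) (j : (E.pullback g).ι) (x : X) (hi : x ∈ (D.pullback g).U i) (hj : x ∈ (E.pullback g).U j) :
    IsUnitAt x ((E.pullback g).f j * functionFieldMap g m / (D.pullback g).f i) := by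
  rw [pullback_f, pullback_f, ← map_mul, ← map_div₀]
  exact (hm i j (g.base x) hi hj).functionFieldMap

variable (D)

/-- **The pulled-back trivialisation, read in `K(X)`**: `η(s) ↦ 𝒪_X(g^*D) ≅_{g^♯h} 𝒪_X` takes the value with rational function
`g^♯(φ_D(s) · h)` — i.e. «pull back, then trivialise by `g^♯h`» computes as `g^♯` of «trivialise by `h`» (★
`ofSection_unitIsoOfRatFn_hom_app`). [cite: GortzWedhorn2020, Prop. 11.50 (b) and Prop. 11.21 (p. 302)] -/
theorem ofSection_unitIsoOfRatFn_pullback_hom_app_unitSection {h : Y.functionField}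
    (hD : ∀ (i : D.ι) (y : Y), y ∈ D.U i → IsUnitAt y (h / D.f i)) {W : Y.Opens} (hW : genericPoint Y ∈ W)
    (s : Γ(Modules.lineBundle D.toUnitCocycle, W)) :
    ofSection (genericPoint_mem_preimage g hW) (show Γ(X, g ⁻¹ᵁ W) from
        ((D.pullback g).unitIsoOfRatFn (functionFieldMap g h) (isUnitAt_div_pullback_f g hD)).hom.app (g ⁻¹ᵁ W)
          ((D.pullbackLineBundleIso g).hom.app (g ⁻¹ᵁ W) (unitSection g (Modules.lineBundle D.toUnitCocycle) W s))) =
      functionFieldMap g (D.lineBundleRatFn hW s * h) := by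
  rw [ofSection_unitIsoOfRatFn_hom_app, D.lineBundleRatFn_pullbackLineBundleIso_hom_app_unitSection g hW, map_mul]

end Literature.AlgebraicGeometry.Motives.CartierDivisor

end
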